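import Mathlib
import Literature.Computability.AlgebraicComplexity.PermanentIrreducible
import Literature.Computability.AlgebraicComplexity.StandardFamiliesProofs

/-!
# Crux `DivisionGap.PerCofactorDegreeReduction` (stmt-ValiantsHypothesis-15046), line `Sketch` —
# stub `stub_supportLaw`: nonnegative members of `(per_n)` live in the permutation monomial ideal

**Theorem (`stub_supportLaw`).** Let `A ∈ ℝ≥0[x_ij]` (`n × n` variables) and suppose
`per_n ∣ A` over `ℝ` (the real cofactor may be SIGNED).  Then every monomial `m` of `A` dominates a
permutation monomial: `μ_σ ≤ m` for some permutation `σ`.  Equivalently, `A` lies in the monomial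
ideal generated by the `n!` permutation monomials.  (Frobenius–König flavour: the nonnegative real
zeros of `per_n` in `{0,1}^{n × n}` are the matching-free support patterns, and a nonnegative
multiple of `per_n` has to vanish at all of them.)

## Proof

Let `ξ = 𝟙[supp m] : [n]² → ℝ≥0` be the `0/1` indicator of the support of `m`.

* No cancellation over `ℝ≥0`: `A(ξ) = Σ_d coeff_d A · ξ^d ≥ coeff_m A · ξ^m = coeff_m A ≠ 0`
  (`MvPolynomial.eval_eq`, `Finset.single_le_sum`; `ξ^m = 1` because `ξ = 1` on `supp m`).
* Push to `ℝ` (`MvPolynomial.eval_map`, `MvPolynomial.eval₂_comp`): `A(ξ) = per_n(ξ) · q(ξ)` where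
  `map A = per_n · q`, so `per_n(ξ) ≠ 0`.
* `per_n(ξ) = Σ_σ Π_i ξ (σ i, i)` (`eval_perPoly`, `Matrix.permanent`), so some permutation `σ` has
  `ξ (σ i, i) ≠ 0`, i.e. `m (σ i, i) ≠ 0`, for every column `i`; this is exactly `μ_σ ≤ m`
  (`permMonomial_le_iff`, from `permMonomial_apply`).

Leans on Mathlib and the tree files `Literature/Computability/AlgebraicComplexity/PermanentIrreducible.lean`
(`permMonomial`, `permMonomial_apply`) and `…/StandardFamilies.lean` (`perPoly`, `eval_perPoly`) only.
-/

noncomputable section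

-- `Summit.ValiantsHypothesis.ValiantsHypothesis.…` is the tree's mandated single-conjunct layout
-- (Problem = Summit), so the duplicated namespace component is intended.
set_option linter.dupNamespace false

namespace Summit.ValiantsHypothesis.ValiantsHypothesis.Theorems.DivisionGap.PerCofactorDegreeReduction.SupportLaw

open MvPolynomial Literature.Computability.AlgebraicComplexity
open scoped NNReal BigOperators

variable {n : ℕ}

/-- `μ_σ ≤ m` iff every cell `(σ i, i)` of the permutation `σ` lies in the support of `m`
(`permMonomial_apply`: `μ_σ (r, c) = [σ c = r]`). [folklore] -/
theorem permMonomial_le_iff (σ : Equiv.Perm (Fin n)) (m : (Fin n × Fin n) →₀ ℕ) :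
    permMonomial σ ≤ m ↔ ∀ i, m (σ i, i) ≠ 0 := by
  constructor
  · intro h i
    have hi := Finsupp.le_def.mp h (σ i, i)
    rw [permMonomial_apply, if_pos rfl] at hi
    exact Nat.one_le_iff_ne_zero.mp hi
  · intro h
    refine Finsupp.le_def.mpr fun e => ?_
    obtain ⟨r, c⟩ := e
    rw [permMonomial_apply]
    split_ifs with hrc
    · subst hrc
      exact Nat.one_le_iff_ne_zero.mpr (h c)
    · exact Nat.zero_le _

/-- **No cancellation over `ℝ≥0`.**  At the `0/1` indicator `ξ = 𝟙[supp m]` of the support of a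
monomial `m` of `A ∈ ℝ≥0[x]`, the value `A(ξ)` is at least `coeff_m A`, hence nonzero. [folklore] -/
theorem eval_indicator_ne_zero (A : MvPolynomial (Fin n × Fin n) ℝ≥0) (m : (Fin n × Fin n) →₀ ℕ)
    (hm : m ∈ A.support) :
    eval (fun e => if m e = 0 then (0 : ℝ≥0) else 1) A ≠ 0 := by
  set ξ : Fin n × Fin n → ℝ≥0 := fun e => if m e = 0 then (0 : ℝ≥0) else 1 with hξ
  have hterm : coeff m A * ∏ i ∈ m.support, ξ i ^ m i = coeff m A := by
    rw [Finset.prod_eq_one, mul_one]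
    intro i hi
    rw [hξ]
    simp only
    rw [if_neg (Finsupp.mem_support_iff.mp hi), one_pow]
  have h1 : coeff m A ≤ eval ξ A := by
    rw [eval_eq]
    calc coeff m A = coeff m A * ∏ i ∈ m.support, ξ i ^ m i := hterm.symm
      _ ≤ ∑ d ∈ A.support, coeff d A * ∏ i ∈ d.support, ξ i ^ d i :=
        Finset.single_le_sum (f := fun d => coeff d A * ∏ i ∈ d.support, ξ i ^ d i)
          (fun d _ => zero_le) hm
  intro h0
  rw [h0] at h1
  exact (mem_support_iff.mp hm) (le_antisymm h1 zero_le)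

/-- **stub_supportLaw — nonnegative ideal members live in the permutation monomial ideal.**  If
`A ≥ 0` (coefficients in `ℝ≥0`) and `per_n ∣ A` over `ℝ`, then every monomial `m` of `A` dominates a
permutation monomial: `μ_σ ≤ m` for some `σ`.  Proof: evaluate `map A = per_n · q` at the `0/1` point
`ξ = 𝟙[supp m]`; `A(ξ) ≥ coeff_m A > 0` (no cancellation), while `per_n(ξ) = Σ_σ Π_i ξ (σ i, i)` counts
the permutations inside `supp m`; if there were none, `per_n(ξ) = 0` would force `A(ξ) = 0`. [folklore] -/
theorem stub_supportLaw (n : ℕ) (A : MvPolynomial (Fin n × Fin n) ℝ≥0)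
    (hA : perPoly (Fin n) ℝ ∣ MvPolynomial.map NNReal.toRealHom A)
    (m : (Fin n × Fin n) →₀ ℕ) (hm : m ∈ A.support) :
    ∃ σ : Equiv.Perm (Fin n), permMonomial σ ≤ m := by
  set ξ : Fin n × Fin n → ℝ≥0 := fun e => if m e = 0 then (0 : ℝ≥0) else 1 with hξ
  have hpos : eval ξ A ≠ 0 := eval_indicator_ne_zero A m hm
  obtain ⟨q, hq⟩ := hA
  -- push the evaluation to `ℝ`: `A(ξ) = per_n(ξ) · q(ξ)`
  have h2 : NNReal.toRealHom (eval ξ A) =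
      eval (⇑NNReal.toRealHom ∘ ξ) (MvPolynomial.map NNReal.toRealHom A) := by
    rw [eval_map, eval₂_comp]
  have hper : eval (⇑NNReal.toRealHom ∘ ξ) (perPoly (Fin n) ℝ) ≠ 0 := by
    intro h0
    apply hpos
    have h : NNReal.toRealHom (eval ξ A) = 0 := by rw [h2, hq, map_mul, h0, zero_mul]
    rwa [NNReal.coe_toRealHom, NNReal.coe_eq_zero] at h
  -- `per_n(ξ) = Σ_σ Π_i ξ (σ i, i)`: a nonzero summand is a permutation inside `supp m`
  rw [eval_perPoly] at hper
  unfold Matrix.permanent at hper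
  obtain ⟨σ, -, hσ⟩ := Finset.exists_ne_zero_of_sum_ne_zero hper
  refine ⟨σ, (permMonomial_le_iff σ m).mpr fun i hi => ?_⟩
  rw [Finset.prod_ne_zero_iff] at hσ
  have h := hσ i (Finset.mem_univ i)
  simp [hξ, hi] at h

end Summit.ValiantsHypothesis.ValiantsHypothesis.Theorems.DivisionGap.PerCofactorDegreeReduction.SupportLaw

end
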